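import Summits.NavierStokesRegularity.OSWSelfSimilar.SheetREvenEnergySpaceOf
import Summits.NavierStokesRegularity.OSWSelfSimilar.SheetRTranslationModeAssembly
import HarnessLib

/-!
# SHEET-ℝ, EVEN half of Z3-SR-SPEC: PO⁺ TRANSPORTED into selfsim's even dictionary — the translation mode `Ω*′` of the weak zero of record
# lies in the domain of Kato's closed operator `T⁺* = generatorEven` with `T⁺*Ω*′ = ½Ω*′ − θ⟪h⁺, Ω*′⟫h⁺`

HONEST FRAMING (cell ns-blowup GROUP B / zone Z3, case Z3-SR-SPEC EVEN half, HYPOTHESIS-LEDGER row PO⁺ «translation gauge mode at `σ = ½`», the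
hypothesis `hv1` of selfsim g14's even assembly `SheetRSpectrumEvenAssembly.eigen_iff_eq_half`; 1-D MODEL certificate frame (viscous gCLM/OSW sheet on the
line, `ν = 1`); not Euler/NS; «violates: none — MODEL»).  Nothing here asserts that a profile exists: `Ω*` enters through the weak zero of record and its
STRONG consequences (cert-1 g8 `SheetRTranslationModeAssembly.translationMode_eigen_and_energy_of_weakZero`: `Ω* ∈ C³`, the pointwise identity
`DG⁺(Ω*)[Ω*′] = −½Ω*′` in the COVARIANT gauge, `Ω*′ ∈ E⁺₀`).  This is the even twin of cert-5 g6's `SheetRTimeShiftModeWeak` + `…WeakEigen` (odd, `σ = 1`):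
The function-language read-backs (`exists_espE_of_profile`, `cplxE`, `realE`, the covariant velocity `∫_{(−∞,ξ]} H[Ω′] = HΩ(ξ)`, integration by parts
against parity-free tests) are the companion file `SheetREvenEnergySpaceOf` (cert-5 g9; split by the ≤ 400-line rule).
* §1 `linForm_sub_popE_eq_of_strong` — STRONG ⇒ WEAK: the pointwise identity with eigenvalue `−½` and covariant velocity gives, on every even test,
  `linForm L (drift a Ω) (potential L λ Ω) v v′ φ φ₁ − ∫ w·(P⁺v)·φ = −½∫ w·v·φ` (`P⁺v = λχ·v + Ω·Hv − aΩ₁·𝒰⁺v` = `PopEFun` of `SheetREvenAssemblyOperators`);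
* §2 `translationMode_isWeakImageE(_of_weakZero)` — packaged as selfsim's `IsWeakImageE hL (−PopCE hL λ a hc + F′) (drift a Ω) (potential L λ Ω) (P, 0)
  (ofPair (F′P − ½·ιEE P, 0))` for EVERY bounded `F′ : EspE →L L²_w`, `P ≠ 0` when `Ω(X₀) ≠ 0`;
* §3 `eigen_half_of_weakZero` — with the REAL rank-one lift `F′ = θ⟪h⁺, ιEE ·⟫h⁺` and `mem_domain_of_weakE`: for ANY Gårding datum `h` of
  `(drift a Ω*, potential L λ Ω*, K* = −PopCE* + F′)` the complex class `v := Ω*′ + 0·i ∈ WcevenZ` is non-zero, lies in `D(T⁺*)` and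
  `T⁺*v = ½v − (θ⟪h⁺ + 0i, v⟫)·(h⁺ + 0i)` — EXACTLY the hypothesis `hv1` (with `hv0`) of `eigen_iff_eq_half` / `eigen_half_simple` / `eigen_set_eq_singleton`.
No definition; no named fact; no `Prop` hypothesis beyond selfsim's structures.  WHAT THIS IS NOT: not NS; not the spectral certificate; no number of record moves.
-/


noncomputable section

namespace Summit.NavierStokesRegularity.OSWSelfSimilar
namespace SheetRTranslationModeWeakEigen

open _root_.MeasureTheory _root_.Set _root_.Filter _root_.Real Literature.Analysis.Fourier SheetRWeakProfilePV SheetRWeakToStrong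
  SheetREnergyClass SheetRWeightedMeasure SheetRWeightedEmbeddings SheetREnergySpace SheetRLinearisedTests SheetRTestSpace
  SheetRLinearisedFormBounds SheetRSolutionOperator SheetRPerturbedSolutionOperator SheetRComplexPivot SheetRResolventConj SheetRAssemblyOperators
  SheetRCertificateAssembly SheetREvenTests SheetREvenEnergySpace SheetREvenForms SheetREvenPairUniqueness SheetREvenClass
  SheetRResolventEvenClass SheetRGeneratorEvenWeak SheetREvenEnergyClass SheetREvenAssemblyOperators SheetRTimeShiftModeWeak
  SheetRTimeShiftModeWeakEigen SheetRWeakEigenReal SheetRSpectrumOddAssemblyReal SheetREvenEnergySpaceOf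
open scoped Topology ENNReal ContDiff InnerProductSpace ComplexConjugate

variable {L : ℝ}

/-! ### §1 STRONG ⇒ WEAK for the even linearised equation at a centre -/

/-- **STRONG ⇒ WEAK (even class).** Let `v ∈ C²` with finite weights `∫ w v², ∫ w v′² < ∞`, and suppose the pointwise linearised equation of
the profile map at `Ω` in an EVEN direction `v`, covariant gauge, eigenvalue `−½`:
`v + ½ξv′ + a(𝒰⁺v·Ω′ + 𝒰Ω·v′) − Hv·Ω − HΩ·v − v″ = −½v` (`𝒰⁺v = ∫_{(−∞,ξ]} Hv`, `𝒰Ω = ∫₀HΩ`). Then for every compactly supported even test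
`(φ, φ₁)` and every `λ`, with `d = drift a Ω`, `V = potential L λ Ω` (any measurable `Ω₁ = Ω′` a.e. in the nonlocal term):
`linForm L d V v v′ φ φ₁ − ∫ w·(λχ·v + Ω·Hv − a·Ω₁·𝒰⁺v)·φ = −½∫ w·v·φ` — one integration by parts of `−v″` against `wφ`.
MODEL statement; not NS. [folklore] -/
theorem linForm_sub_popE_eq_of_strong (hL : 0 < L) (lam a : ℝ) {Ω Ω₁ v : ℝ → ℝ} {D₀ V₀ : ℝ}
    (hΩ₁ : Ω₁ =ᵐ[volume] deriv Ω)
    (hdm : AEStronglyMeasurable (drift a Ω) volume) (hVm : AEStronglyMeasurable (potential L lam Ω) volume)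
    (hd : ∀ ξ, |drift a Ω ξ| ≤ D₀ + 1 / 2 * |ξ|) (hV : ∀ ξ, |potential L lam Ω ξ| ≤ V₀)
    (hv : ContDiff ℝ 2 v) (hvw0 : Integrable fun y => (L ^ 2 + y ^ 2) * v y ^ 2)
    (hvw1 : Integrable fun y => (L ^ 2 + y ^ 2) * deriv v y ^ 2)
    (hstrong : ∀ X, v X + 1 / 2 * X * deriv v X
        + a * ((∫ s in Iic X, hilbertTransform v s) * deriv Ω X + (∫ s in (0 : ℝ)..X, hilbertTransform Ω s) * deriv v X)
        - hilbertTransform v X * Ω X - hilbertTransform Ω X * v X - iteratedDeriv 2 v X = -(1 / 2) * v X)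
    (hPint : ∀ {φ φ₁ : ℝ → ℝ}, IsCompactTestE φ φ₁ → Integrable fun y => (L ^ 2 + y ^ 2) *
        ((lam * (L ^ 2 / (L ^ 2 + y ^ 2)) * v y + Ω y * hilbertTransform v y
          - a * Ω₁ y * ∫ s in Iic y, hilbertTransform v s) * φ y))
    {φ φ₁ : ℝ → ℝ} (hφ : IsCompactTestE φ φ₁) :
    linForm L (drift a Ω) (potential L lam Ω) v (deriv v) φ φ₁
        - ∫ y, (L ^ 2 + y ^ 2) * ((lam * (L ^ 2 / (L ^ 2 + y ^ 2)) * v y + Ω y * hilbertTransform v y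
            - a * Ω₁ y * ∫ s in Iic y, hilbertTransform v s) * φ y) =
      -(1 / 2) * ∫ y, (L ^ 2 + y ^ 2) * (v y * φ y) := by
  have hφa := hφ.toIsCompactTestAny
  obtain ⟨hφc, -, -, hφK⟩ := basic_of_any hφa
  have hvc : Continuous v := hv.continuous
  have hv1 : ContDiff ℝ 1 (deriv v) := (contDiff_succ_iff_deriv.1 hv).2.2
  have hv'c : Continuous (deriv v) := hv1.continuous
  have hd1 : ∀ y, HasDerivAt (deriv v) (deriv (deriv v) y) y := fun y =>
    ((hv1.differentiable one_ne_zero) y).hasDerivAt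
  have hit : ∀ y, iteratedDeriv 2 v y = deriv (deriv v) y := fun y => by
    rw [show (2 : ℕ) = 1 + 1 from rfl, iteratedDeriv_succ, iteratedDeriv_one]
  -- the multiplier `g = w·v′ ∈ C¹` and its derivative
  set g : ℝ → ℝ := fun y => (L ^ 2 + y ^ 2) * deriv v y with hg
  have hgC : ContDiff ℝ 1 g := by rw [hg]; exact (by fun_prop : ContDiff ℝ 1 fun y : ℝ => L ^ 2 + y ^ 2).mul hv1
  have hgd : ∀ y, deriv g y = 2 * y * deriv v y + (L ^ 2 + y ^ 2) * deriv (deriv v) y := by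
    intro y
    have hw : HasDerivAt (fun y : ℝ => L ^ 2 + y ^ 2) (2 * y) y := by
      have := ((hasDerivAt_id y).pow 2).const_add (L ^ 2)
      simpa using this
    have h : HasDerivAt (fun y => (L ^ 2 + y ^ 2) * deriv v y) (2 * y * deriv v y + (L ^ 2 + y ^ 2) * deriv (deriv v) y) y :=
      hw.mul (hd1 y)
    rw [hg, h.deriv]
  -- (A) integration by parts: `∫ (2ξv′ + wv″)·φ = −∫ w v′ φ₁`
  have hA := integral_deriv_mul_testAny hgC hφa
  -- integrability of the weak-form integrand, the `P⁺`-term, the pivot term and the boundary integrand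
  obtain ⟨hI, -⟩ := abs_linForm_le_any (d := drift a Ω) (V := potential L lam Ω) hL hdm hVm (by norm_num : (0:ℝ) ≤ 1 / 2) hd hV hφa
    hvc.aestronglyMeasurable hv'c.aestronglyMeasurable hvw0 hvw1
  have hP := hPint hφ
  have hVw : Integrable fun y => (L ^ 2 + y ^ 2) * (v y * φ y) := by
    have e : (fun y => (L ^ 2 + y ^ 2) * (v y * φ y)) = fun y => ((L ^ 2 + y ^ 2) * v y) * φ y := by
      funext y; ring
    rw [e]
    exact Continuous.integrable_of_hasCompactSupport (by fun_prop) hφK.mul_left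
  have hG2 : Integrable fun y => deriv g y * φ y :=
    Continuous.integrable_of_hasCompactSupport ((hgC.continuous_deriv le_rfl).mul hφc) hφK.mul_left
  -- (B) the pointwise identity, a.e. (where `Ω₁ = Ω′`)
  have hB : ∀ᵐ y : ℝ,
      ((L ^ 2 + y ^ 2) * (deriv v y * φ₁ y) + 2 * y * (deriv v y * φ y) + (L ^ 2 + y ^ 2) * drift a Ω y * (deriv v y * φ y)
          + (L ^ 2 + y ^ 2) * potential L lam Ω y * (v y * φ y))
        - (L ^ 2 + y ^ 2) * ((lam * (L ^ 2 / (L ^ 2 + y ^ 2)) * v y + Ω y * hilbertTransform v y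
            - a * Ω₁ y * ∫ s in Iic y, hilbertTransform v s) * φ y)
        + (1 / 2) * ((L ^ 2 + y ^ 2) * (v y * φ y)) =
      (L ^ 2 + y ^ 2) * deriv v y * φ₁ y + deriv g y * φ y := by
    filter_upwards [hΩ₁] with y hy
    have hs := hstrong y
    rw [hit y] at hs
    rw [hy, hgd y]
    unfold drift potential
    have hE : v y + 1 / 2 * y * deriv v y
        + a * ((∫ s in Iic y, hilbertTransform v s) * deriv Ω y + (∫ s in (0 : ℝ)..y, hilbertTransform Ω s) * deriv v y)
        - hilbertTransform v y * Ω y - hilbertTransform Ω y * v y + 1 / 2 * v y = deriv (deriv v) y := by linarith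
    rw [← hE]
    ring
  -- (C) integrate
  have hG1 : Integrable fun y => (L ^ 2 + y ^ 2) * deriv v y * φ₁ y := by
    have h := ((hI.sub hP).add (hVw.const_mul (1 / 2))).sub hG2
    refine h.congr ?_
    filter_upwards [hB] with y hy
    simp only [Pi.sub_apply, Pi.add_apply] at hy ⊢
    linarith
  have hlin : linForm L (drift a Ω) (potential L lam Ω) v (deriv v) φ φ₁ =
      ∫ y, ((L ^ 2 + y ^ 2) * (deriv v y * φ₁ y) + 2 * y * (deriv v y * φ y) + (L ^ 2 + y ^ 2) * drift a Ω y * (deriv v y * φ y)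
          + (L ^ 2 + y ^ 2) * potential L lam Ω y * (v y * φ y)) := rfl
  have eB := integral_congr_ae hB
  have eL : (∫ y, ((L ^ 2 + y ^ 2) * (deriv v y * φ₁ y) + 2 * y * (deriv v y * φ y) + (L ^ 2 + y ^ 2) * drift a Ω y * (deriv v y * φ y)
          + (L ^ 2 + y ^ 2) * potential L lam Ω y * (v y * φ y))
        - (L ^ 2 + y ^ 2) * ((lam * (L ^ 2 / (L ^ 2 + y ^ 2)) * v y + Ω y * hilbertTransform v y
            - a * Ω₁ y * ∫ s in Iic y, hilbertTransform v s) * φ y)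
        + (1 / 2) * ((L ^ 2 + y ^ 2) * (v y * φ y))) =
      (∫ y, ((L ^ 2 + y ^ 2) * (deriv v y * φ₁ y) + 2 * y * (deriv v y * φ y) + (L ^ 2 + y ^ 2) * drift a Ω y * (deriv v y * φ y)
          + (L ^ 2 + y ^ 2) * potential L lam Ω y * (v y * φ y)))
        - (∫ y, (L ^ 2 + y ^ 2) * ((lam * (L ^ 2 / (L ^ 2 + y ^ 2)) * v y + Ω y * hilbertTransform v y
            - a * Ω₁ y * ∫ s in Iic y, hilbertTransform v s) * φ y))
        + (1 / 2) * (∫ y, (L ^ 2 + y ^ 2) * (v y * φ y)) := by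
    rw [integral_add _ (hVw.const_mul (1 / 2)), integral_sub hI hP, integral_const_mul]
    exact hI.sub hP
  have eR := integral_add hG1 hG2
  have hgφ : ∫ y, g y * φ₁ y = ∫ y, (L ^ 2 + y ^ 2) * deriv v y * φ₁ y := rfl
  rw [hlin]
  linarith

/-! ### §2 PO⁺ in the assembly's predicates: the translation mode as an even weak image datum -/

/-- **PO⁺ TRANSPORTED (strong data).** Let `hc : IsCentre L Ω Ω₁ H₀` be a centre datum with `Ω ∈ C³` in the decay class, and let `v = Ω′` be even,
zero-mass, with finite weights, satisfying the pointwise linearised equation with eigenvalue `−½` in the covariant gauge (the conclusions of cert-1 g8's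
`translationMode_eigen_and_energy(_of_weakZero)` at `ν = 1`). Then there is `P ∈ EspE L hL` with `profile P = v`, `derE P = v′` a.e., and for EVERY
bounded `F′ : EspE →L L²_w` the pair `(P, 0)` is an even WEAK IMAGE datum
`IsWeakImageE hL (−PopCE hL λ a hc + F′) (drift a Ω) (potential L λ Ω) (P, 0) (ofPair (F′P − ½·ιEE P, 0))` — i.e. `(DG⁺(Ω) + F′)v = F′v − ½v` weakly on the
zero-mass even tests, `DG⁺(Ω) = B_λ − P⁺_Ω`. MODEL statement; not NS. [folklore] -/
theorem translationMode_isWeakImageE (hL : 0 < L) (lam a : ℝ) {Ω Ω₁ : ℝ → ℝ} {H₀ : ℝ} (hc : IsCentre L Ω Ω₁ H₀)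
    (hΩ : ContDiff ℝ 3 Ω) {M C : ℝ} (hM : ∀ y, |deriv (deriv Ω) y| ≤ M) (hC : ∀ y, |deriv Ω y| ≤ C / (1 + y ^ 2))
    {v : ℝ → ℝ} (hv : v = deriv Ω) (hveven : ∀ y, v (-y) = v y)
    (hvw0 : Integrable fun y => (L ^ 2 + y ^ 2) * v y ^ 2) (hvw1 : Integrable fun y => (L ^ 2 + y ^ 2) * deriv v y ^ 2)
    (hvz : ∫ y, v y = 0)
    (hstrong : ∀ X, v X + 1 / 2 * X * deriv v X
        + a * (hilbertTransform Ω X * deriv Ω X + (∫ s in (0 : ℝ)..X, hilbertTransform Ω s) * deriv v X)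
        - hilbertTransform v X * Ω X - hilbertTransform Ω X * v X - iteratedDeriv 2 v X = -(1 / 2) * v X) :
    ∃ P : EspE L hL, profile P = v ∧ (derE P =ᵐ[volume] deriv v) ∧
      ∀ F' : EspE L hL →L[ℝ] W L,
        IsWeakImageE hL (-PopCE hL lam a hc + F') (drift a Ω) (potential L lam Ω)
          (WithLp.toLp 2 (P, (0 : EspE L hL))) (ofPair L (WithLp.toLp 2 (F' P - (1 / 2 : ℝ) • ιEE hL P, (0 : W L)))) := by
  -- regularity of `v = Ω′`
  have hv2 : ContDiff ℝ 2 v := by rw [hv]; exact (contDiff_succ_iff_deriv.1 hΩ).2.2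
  have hv1 : ContDiff ℝ 1 v := hv2.of_le (by norm_num)
  have hv'c : Continuous (deriv v) := hv1.continuous_deriv le_rfl
  have hvprim : ∀ x, v x = v 0 + ∫ s in (0 : ℝ)..x, deriv v s := fun x => by
    rw [intervalIntegral.integral_deriv_eq_sub (fun y _ => (hv1.differentiable one_ne_zero) y) (hv'c.intervalIntegrable _ _)]
    ring
  obtain ⟨P, hPv, hPd⟩ := exists_espE_of_profile hL hvprim hveven hv'c.aestronglyMeasurable hvw0 hvw1 hvz
  obtain ⟨hdm, hVm, hd, hV⟩ := coef_bounds hL lam a hc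
  have hΩ₁ := ae_eq_deriv_of_isCentre hL hc (hΩ.of_le (by norm_num))
  -- the covariant velocity of `v = Ω′` is `HΩ`
  obtain ⟨-, -, -, hΩi, -⟩ := hc.basic hL
  obtain ⟨hHm, -, hwH, -⟩ := weightedSq_hilbertTransform_of_primitive hL hc.primitive' hc.odd hc.measurable hc.weight₀ hc.weight₁
  have hHi : Integrable (hilbertTransform Ω) := integrable_of_weighted_sq hL hHm hwH
  obtain ⟨-, hHvi, -, -⟩ := hilbertE_of_mem hL P
  rw [hPv] at hHvi
  have hcov : ∀ X, ∫ s in Iic X, hilbertTransform v s = hilbertTransform Ω X := fun X => by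
    rw [hv] at hHvi ⊢; exact setIntegral_Iic_hilbertTransform_deriv hΩ hΩi hM hC hHi hHvi X
  have hstrong' : ∀ X, v X + 1 / 2 * X * deriv v X
      + a * ((∫ s in Iic X, hilbertTransform v s) * deriv Ω X + (∫ s in (0 : ℝ)..X, hilbertTransform Ω s) * deriv v X)
      - hilbertTransform v X * Ω X - hilbertTransform Ω X * v X - iteratedDeriv 2 v X = -(1 / 2) * v X := fun X => by
    rw [hcov X]; exact hstrong X
  -- the `P⁺`-term: a.e. formula and integrability against even tests
  have hPopfun : ∀ y, PopEFun L lam a Ω Ω₁ P y =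
      (lam * (L ^ 2 / (L ^ 2 + y ^ 2)) * v y + Ω y * hilbertTransform v y - a * Ω₁ y * ∫ s in Iic y, hilbertTransform v s) := by
    intro y; simp only [PopEFun, hPv]
  have hPopae := PopCE_apply hL lam a hc P
  have hPint : ∀ {φ φ₁ : ℝ → ℝ}, IsCompactTestE φ φ₁ → Integrable fun y => (L ^ 2 + y ^ 2) *
      ((lam * (L ^ 2 / (L ^ 2 + y ^ 2)) * v y + Ω y * hilbertTransform v y
        - a * Ω₁ y * ∫ s in Iic y, hilbertTransform v s) * φ y) := by
    intro φ φ₁ hφ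
    refine (integrable_weight_mul_any hL (PopCE hL lam a hc P) hφ.toIsCompactTestAny).1.congr ?_
    filter_upwards [hPopae] with y hy
    rw [hy, hPopfun y]
  refine ⟨P, hPv, hPd, fun F' => ?_⟩
  intro φ φ₁ hφ h0
  have hcore := linForm_sub_popE_eq_of_strong hL lam a hΩ₁ hdm hVm hd hV hv2 hvw0 hvw1 hstrong' hPint hφ
  -- read-backs
  have hPdata : ∫ y, (L ^ 2 + y ^ 2) * ((lam * (L ^ 2 / (L ^ 2 + y ^ 2)) * v y + Ω y * hilbertTransform v y
        - a * Ω₁ y * ∫ s in Iic y, hilbertTransform v s) * φ y) = PdataE hL (PopCE hL lam a hc P) ⟨(φ, φ₁), hφ, h0⟩ := by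
    rw [PdataE_apply]
    refine integral_congr_ae ?_
    filter_upwards [hPopae] with y hy
    show (L ^ 2 + y ^ 2) * ((lam * (L ^ 2 / (L ^ 2 + y ^ 2)) * v y + Ω y * hilbertTransform v y
        - a * Ω₁ y * ∫ s in Iic y, hilbertTransform v s) * φ y) = (L ^ 2 + y ^ 2) * (((PopCE hL lam a hc P : W L) : ℝ → ℝ) y * φ y)
    rw [hy, hPopfun y]
  have hιdata : ∫ y, (L ^ 2 + y ^ 2) * (v y * φ y) = PdataE hL (ιEE hL P) ⟨(φ, φ₁), hφ, h0⟩ := by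
    rw [PdataE_apply]
    refine integral_congr_ae ?_
    filter_upwards [ιEE_ae hL P] with y hy
    show (L ^ 2 + y ^ 2) * (v y * φ y) = (L ^ 2 + y ^ 2) * (((ιEE hL P : W L) : ℝ → ℝ) y * φ y)
    rw [hy, hPv]
  rw [hPdata, hιdata] at hcore
  have h12 : (0 : ℝ) ≤ 1 / 2 := by norm_num
  have hfst : (WithLp.toLp 2 (P, (0 : EspE L hL))).fst = P := rfl
  have hsnd : (WithLp.toLp 2 (P, (0 : EspE L hL))).snd = 0 := rfl
  have hre : reW L (ofPair L (WithLp.toLp 2 (F' P - (1 / 2 : ℝ) • ιEE hL P, (0 : W L)))) = F' P - (1 / 2 : ℝ) • ιEE hL P := by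
    rw [← (toPair_fst_snd _).1, toPair_ofPair]; rfl
  have him : imW L (ofPair L (WithLp.toLp 2 (F' P - (1 / 2 : ℝ) • ιEE hL P, (0 : W L)))) = 0 := by
    rw [← (toPair_fst_snd _).2, toPair_ofPair]; rfl
  have hlinP : linForm L (drift a Ω) (potential L lam Ω) (profile P) (derE P) φ φ₁ =
      linForm L (drift a Ω) (potential L lam Ω) v (deriv v) φ φ₁ :=
    linForm_congr_ae L _ _ (Eventually.of_forall fun y => congrFun hPv y) hPd
  have hlin0 : linForm L (drift a Ω) (potential L lam Ω) (profile (0 : EspE L hL)) (derE (0 : EspE L hL)) φ φ₁ = 0 := by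
    have h := (EformE_apply hL hdm hVm h12 hd hV (0 : EspE L hL) ⟨(φ, φ₁), hφ, h0⟩).symm
    rw [map_zero, LinearMap.zero_apply] at h
    exact h
  rw [hfst, hsnd, hre, him]
  refine ⟨?_, ?_⟩
  · rw [hlinP, ← PdataE_apply hL ((-PopCE hL lam a hc + F') P) ⟨(φ, φ₁), hφ, h0⟩,
      ← PdataE_apply hL (F' P - (1 / 2 : ℝ) • ιEE hL P) ⟨(φ, φ₁), hφ, h0⟩, _root_.add_apply, _root_.neg_apply,
      map_add (PdataE hL), map_neg (PdataE hL), map_sub (PdataE hL), map_smul (PdataE hL), LinearMap.add_apply, LinearMap.neg_apply,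
      LinearMap.sub_apply, LinearMap.smul_apply, smul_eq_mul]
    linarith
  · rw [hlin0, map_zero, integral_weight_zeroW hL]
    norm_num

/-- **PO⁺ TRANSPORTED, for a GIVEN centre datum of the weak zero of record** (`ν = 1`, frame `L`, model parameter `a`, any `λ`): if the centre `Ω`
of `hc : IsCentre L Ω Ω₁ H₀` is an E-weak zero (the profile equation against every `C_c^∞` test), there is `P ∈ EspE L hL` with `profile P = Ω′`,
`P ≠ 0` as soon as `Ω X₀ ≠ 0`, such that `(P, 0)` is an even weak image datum
`IsWeakImageE hL (−PopCE hL λ a hc + F′) (drift a Ω) (potential L λ Ω) (P, 0) (ofPair (F′P − ½ιEE P, 0))` for every bounded `F′` — the PO⁺ hypothesis of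
the even S2⁺ kernel assembly for the data of record, up to the instantiation's `F′ = θ⟪h⁺, ·⟫h⁺` (§3). (`Ω ∈ C³`, the decay class and the translation
identity come from cert-1 g8's `translationMode_eigen_and_energy_of_weakZero` and cert-5 g5's `decayClass`.) MODEL statement; not NS. [folklore] -/
theorem translationMode_isWeakImageE_of_centre (hL : 0 < L) (lam a : ℝ) {Ω Ω₁ : ℝ → ℝ} {H₀ : ℝ} (hc : IsCentre L Ω Ω₁ H₀)
    (hweak : ∀ ψ : ℝ → ℝ, ContDiff ℝ ∞ ψ → HasCompactSupport ψ →
      (∫ x, (Ω x + 1 / 2 * x * Ω₁ x + a * (∫ s in (0 : ℝ)..x, hilbertTransform Ω s) * Ω₁ x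
        - hilbertTransform Ω x * Ω x) * ψ x) + ∫ x, Ω₁ x * deriv ψ x = 0) :
    ∃ P : EspE L hL, profile P = deriv Ω ∧ (∀ X₀, Ω X₀ ≠ 0 → P ≠ 0) ∧
      ∀ F' : EspE L hL →L[ℝ] W L,
        IsWeakImageE hL (-PopCE hL lam a hc + F') (drift a Ω) (potential L lam Ω)
          (WithLp.toLp 2 (P, (0 : EspE L hL))) (ofPair L (WithLp.toLp 2 (F' P - (1 / 2 : ℝ) • ιEE hL P, (0 : W L)))) := by
  have hweak' : ∀ ψ : ℝ → ℝ, ContDiff ℝ ∞ ψ → HasCompactSupport ψ →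
      (∫ x, (Ω x + 1 / 2 * x * Ω₁ x + a * (∫ s in (0 : ℝ)..x, hilbertTransform Ω s) * Ω₁ x
        - hilbertTransform Ω x * Ω x) * ψ x) + 1 * ∫ x, Ω₁ x * deriv ψ x = 0 := fun ψ hψ hψc => by
    rw [one_mul]; exact hweak ψ hψ hψc
  obtain ⟨⟨hΩ3, hG⟩, hveq, hveven, hvw0, hvw1, hvz⟩ :=
    SheetRTranslationModeAssembly.translationMode_eigen_and_energy_of_weakZero (a := a) hL one_pos hc.primitive hc.odd hc.measurable
      hc.weight₀ hc.weight₁ hweak' rfl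
  have hΩ2 : ContDiff ℝ 2 Ω := hΩ3.of_le (by norm_num)
  obtain ⟨-, -, -, ⟨M, hM⟩, ⟨C, hC⟩⟩ := SheetRTimeShiftModeAssembly.decayClass hL one_pos hΩ2 hc.odd hc.weight₀ hvw0 hG
  have hstrong : ∀ X, deriv Ω X + 1 / 2 * X * deriv (deriv Ω) X
      + a * (hilbertTransform Ω X * deriv Ω X + (∫ s in (0 : ℝ)..X, hilbertTransform Ω s) * deriv (deriv Ω) X)
      - hilbertTransform (deriv Ω) X * Ω X - hilbertTransform Ω X * deriv Ω X - iteratedDeriv 2 (deriv Ω) X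
      = -(1 / 2) * deriv Ω X := fun X => by
    have h := hveq X
    rw [one_mul] at h
    exact h
  obtain ⟨P, hPv, -, hW⟩ := translationMode_isWeakImageE hL lam a hc hΩ3 hM hC rfl hveven hvw0 hvw1 hvz hstrong
  refine ⟨P, hPv, fun X₀ hX₀ => ?_, hW⟩
  obtain ⟨X, hX⟩ := SheetRTranslationModeAssembly.translationMode_ne_zero_of_weakZero (a := a) hL one_pos hc.primitive hc.odd hc.measurable
    hc.weight₀ hc.weight₁ hweak' hX₀
  exact espE_ne_zero_of_apply_ne_zero hL hPv hX

/-- **PO⁺ TRANSPORTED, from the weak zero of record** in the function language (`Ω = ∫₀Ω₁` odd, finite weights, E-weak zero): a centre datum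
`hc : IsCentre L Ω Ω₁ H₀` exists (`|HΩ| ≤ H₀` from `SheetRProfileRegularity.exists_bounds`) and `translationMode_isWeakImageE_of_centre` applies.
MODEL statement; not NS. [folklore] -/
theorem translationMode_isWeakImageE_of_weakZero {a : ℝ} (hL : 0 < L) (lam : ℝ) {Ω Ω₁ : ℝ → ℝ}
    (hΩ : ∀ x, Ω x = ∫ s in (0 : ℝ)..x, Ω₁ s) (hodd : ∀ y, Ω (-y) = -Ω y)
    (hΩ₁m : AEStronglyMeasurable Ω₁ volume)
    (hwΩ : Integrable fun y => (L ^ 2 + y ^ 2) * Ω y ^ 2) (hwΩ₁ : Integrable fun y => (L ^ 2 + y ^ 2) * Ω₁ y ^ 2)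
    (hweak : ∀ ψ : ℝ → ℝ, ContDiff ℝ ∞ ψ → HasCompactSupport ψ →
      (∫ x, (Ω x + 1 / 2 * x * Ω₁ x + a * (∫ s in (0 : ℝ)..x, hilbertTransform Ω s) * Ω₁ x
        - hilbertTransform Ω x * Ω x) * ψ x) + ∫ x, Ω₁ x * deriv ψ x = 0) :
    ∃ (H₀ : ℝ) (hc : IsCentre L Ω Ω₁ H₀) (P : EspE L hL),
      profile P = deriv Ω ∧ (∀ X₀, Ω X₀ ≠ 0 → P ≠ 0) ∧
      ∀ F' : EspE L hL →L[ℝ] W L,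
        IsWeakImageE hL (-PopCE hL lam a hc + F') (drift a Ω) (potential L lam Ω)
          (WithLp.toLp 2 (P, (0 : EspE L hL))) (ofPair L (WithLp.toLp 2 (F' P - (1 / 2 : ℝ) • ιEE hL P, (0 : W L)))) := by
  have hweak' : ∀ ψ : ℝ → ℝ, ContDiff ℝ ∞ ψ → HasCompactSupport ψ →
      (∫ x, (Ω x + 1 / 2 * x * Ω₁ x + a * (∫ s in (0 : ℝ)..x, hilbertTransform Ω s) * Ω₁ x
        - hilbertTransform Ω x * Ω x) * ψ x) + 1 * ∫ x, Ω₁ x * deriv ψ x = 0 := fun ψ hψ hψc => by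
    rw [one_mul]; exact hweak ψ hψ hψc
  obtain ⟨⟨hΩ3, -⟩, -, -, hvw0, -, -⟩ :=
    SheetRTranslationModeAssembly.translationMode_eigen_and_energy_of_weakZero (a := a) hL one_pos hΩ hodd hΩ₁m hwΩ hwΩ₁ hweak' rfl
  obtain ⟨-, H₀, -, -, hH, -⟩ := SheetRProfileRegularity.exists_bounds hL (hΩ3.of_le (by norm_num)) hodd hwΩ hvw0
  have hc : IsCentre L Ω Ω₁ H₀ := ⟨hΩ, hodd, hΩ₁m, hwΩ, hwΩ₁, hH⟩
  exact ⟨H₀, hc, translationMode_isWeakImageE_of_centre hL lam a hc hweak⟩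

/-! ### §3 From the weak image datum to Kato's operator `T⁺ = generatorEven` with the real rank-one lift -/

variable {D₀ D₁ V₀ c m : ℝ} {d V : ℝ → ℝ}

/-- **WEAK IMAGE ⇒ EIGENVECTOR OF `T⁺ + θ⟪h⁺,·⟫h⁺` AT `½`.** If `(P, 0)` is an even weak image datum `IsWeakImageE hL K d V (P, 0) (ofPair (F′P − ½ιEE P, 0))`
for the REAL rank-one lift `F′ = θ⟪h⁺, ιEE ·⟫h⁺` (`h⁺ ∈ WevenZ`), then for ANY Gårding datum `h` of `(d, V, K)` with `−m < ½` the complex class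
`v = cplxE P` lies in `D(T⁺)` (`T⁺ = generatorEven hL K h (1/2) _`) and `T⁺v = ½v − (θ⟪h⁺ + 0i, v⟫)·(h⁺ + 0i)` (selfsim's `mem_domain_of_weakE`).
This is the hypothesis `hv1` of `SheetRSpectrumEvenAssembly.eigen_iff_eq_half`. [folklore] -/
theorem eigen_half_of_isWeakImageE (hL : 0 < L) {K : EspE L hL →L[ℝ] W L} (h : GardingDataKE L hL d V K D₀ D₁ V₀ c m)
    (hm : -m < ((1 : ℂ) / 2).re) {hE : W L} (hhE : hE ∈ WevenZ hL) (θ : ℝ) {P : EspE L hL}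
    (hW : IsWeakImageE hL K d V (WithLp.toLp 2 (P, (0 : EspE L hL)))
      (ofPair L (WithLp.toLp 2 ((θ • ((innerSL ℝ hE).comp (ιEE hL))).smulRight hE P - (1 / 2 : ℝ) • ιEE hL P, (0 : W L))))) :
    ∃ hu : cplxE hL P ∈ (generatorEven hL K h ((1 : ℂ) / 2) hm).domain,
      generatorEven hL K h ((1 : ℂ) / 2) hm ⟨cplxE hL P, hu⟩ =
        ((1 : ℂ) / 2) • cplxE hL P - ((θ : ℂ) * innerSL ℂ (realE hL hE hhE) (cplxE hL P)) • realE hL hE hhE := by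
  set F : WcevenZ hL := ((θ : ℂ) * innerSL ℂ (realE hL hE hhE) (cplxE hL P)) • realE hL hE hhE - ((1 : ℂ) / 2) • cplxE hL P with hFdef
  -- the complex datum IS the real one
  have hinner : innerSL ℂ (realE hL hE hhE) (cplxE hL P) = ((⟪hE, ιEE hL P⟫_ℝ : ℝ) : ℂ) := by
    rw [innerSL_apply_apply, Submodule.coe_inner, coe_realE, (coe_cplxE hL P).1, inner_ofRealW]
  have hFc : (F : Wc L) = ofPair L (WithLp.toLp 2 ((θ • ((innerSL ℝ hE).comp (ιEE hL))).smulRight hE P - (1 / 2 : ℝ) • ιEE hL P, (0 : W L))) := by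
    rw [hFdef, Submodule.coe_sub, Submodule.coe_smul, Submodule.coe_smul, coe_realE, (coe_cplxE hL P).1, hinner, rankOneLiftE_apply,
      ← Complex.ofReal_mul, show ((1 : ℂ) / 2) = (((1 / 2 : ℝ)) : ℂ) by push_cast; ring]
    have hs1 : ((θ * ⟪hE, ιEE hL P⟫_ℝ : ℝ) : ℂ) • ofRealW L hE = (θ * ⟪hE, ιEE hL P⟫_ℝ) • ofRealW L hE :=
      (RCLike.real_smul_eq_coe_smul (K := ℂ) _ _).symm
    have hs2 : ((1 / 2 : ℝ) : ℂ) • ofRealW L (ιEE hL P) = (1 / 2 : ℝ) • ofRealW L (ιEE hL P) :=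
      (RCLike.real_smul_eq_coe_smul (K := ℂ) _ _).symm
    have e3 : ofRealW L ((θ * ⟪hE, ιEE hL P⟫_ℝ) • hE - (1 / 2 : ℝ) • ιEE hL P) =
        (θ * ⟪hE, ιEE hL P⟫_ℝ) • ofRealW L hE - (1 / 2 : ℝ) • ofRealW L (ιEE hL P) := by
      rw [map_sub, map_smul, map_smul]
    have e := toPair_ofRealW (L := L) ((θ * ⟪hE, ιEE hL P⟫_ℝ) • hE - (1 / 2 : ℝ) • ιEE hL P)
    rw [hs1, hs2, ← e3, ← e, ofPair_toPair]
  have hw : IsWeakImageE hL K d V (WithLp.toLp 2 (P, (0 : EspE L hL))) (F : Wc L) := by rw [hFc]; exact hW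
  obtain ⟨hu, hT⟩ := mem_domain_of_weakE hL K h hm (u := cplxE hL P) (F := F) (coe_cplxE hL P).2 hw
  refine ⟨hu, ?_⟩
  rw [hT, hFdef]
  abel

/-- **PO⁺ FOR THE DATA OF RECORD, in the even assembly's language (given centre datum).** If the centre `Ω` of `hc` is an E-weak zero with
`Ω X₀ ≠ 0`, `h⁺ ∈ WevenZ` is the real lift vector and `θ` real: there is `P ∈ EspE L hL` (`profile P = Ω′`) with `v := cplxE P ≠ 0` such that for EVERY
Gårding datum `h` of `(drift a Ω, potential L λ Ω, K = −PopCE hL λ a hc + θ⟪h⁺, ιEE ·⟫h⁺)` with `−m < ½`: `v ∈ D(T⁺)` and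
`T⁺v = ½v − (θ⟪h⁺ + 0i, v⟫)(h⁺ + 0i)` — the pair `hv0`, `hv1` of selfsim's `eigen_iff_eq_half` / `eigen_half_simple` / `eigen_set_eq_singleton`.
MODEL statement; not NS. [folklore] -/
theorem eigen_half_of_centre (hL : 0 < L) (lam a : ℝ) {Ω Ω₁ : ℝ → ℝ} {H₀ : ℝ} (hc : IsCentre L Ω Ω₁ H₀)
    (hweak : ∀ ψ : ℝ → ℝ, ContDiff ℝ ∞ ψ → HasCompactSupport ψ →
      (∫ x, (Ω x + 1 / 2 * x * Ω₁ x + a * (∫ s in (0 : ℝ)..x, hilbertTransform Ω s) * Ω₁ x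
        - hilbertTransform Ω x * Ω x) * ψ x) + ∫ x, Ω₁ x * deriv ψ x = 0)
    {X₀ : ℝ} (hX₀ : Ω X₀ ≠ 0) {hE : W L} (hhE : hE ∈ WevenZ hL) (θ : ℝ) :
    ∃ P : EspE L hL, profile P = deriv Ω ∧ cplxE hL P ≠ 0 ∧
      ∀ {D₀ D₁ V₀ c m : ℝ}
        (h : GardingDataKE L hL (drift a Ω) (potential L lam Ω) (-PopCE hL lam a hc + (θ • ((innerSL ℝ hE).comp (ιEE hL))).smulRight hE)
          D₀ D₁ V₀ c m) (hm : -m < ((1 : ℂ) / 2).re),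
        ∃ hu : cplxE hL P ∈ (generatorEven hL _ h ((1 : ℂ) / 2) hm).domain,
          generatorEven hL _ h ((1 : ℂ) / 2) hm ⟨cplxE hL P, hu⟩ =
            ((1 : ℂ) / 2) • cplxE hL P - ((θ : ℂ) * innerSL ℂ (realE hL hE hhE) (cplxE hL P)) • realE hL hE hhE := by
  obtain ⟨P, hPv, hP0, hW⟩ := translationMode_isWeakImageE_of_centre hL lam a hc hweak
  exact ⟨P, hPv, cplxE_ne_zero hL (hP0 X₀ hX₀), fun h hm =>
    eigen_half_of_isWeakImageE hL h hm hhE θ (hW ((θ • ((innerSL ℝ hE).comp (ιEE hL))).smulRight hE))⟩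

/-- **PO⁺ FOR THE DATA OF RECORD, from the weak zero in the function language** (a centre datum is produced). MODEL statement; not NS. [folklore] -/
theorem eigen_half_of_weakZero {a : ℝ} (hL : 0 < L) (lam : ℝ) {Ω Ω₁ : ℝ → ℝ}
    (hΩ : ∀ x, Ω x = ∫ s in (0 : ℝ)..x, Ω₁ s) (hodd : ∀ y, Ω (-y) = -Ω y)
    (hΩ₁m : AEStronglyMeasurable Ω₁ volume)
    (hwΩ : Integrable fun y => (L ^ 2 + y ^ 2) * Ω y ^ 2) (hwΩ₁ : Integrable fun y => (L ^ 2 + y ^ 2) * Ω₁ y ^ 2)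
    (hweak : ∀ ψ : ℝ → ℝ, ContDiff ℝ ∞ ψ → HasCompactSupport ψ →
      (∫ x, (Ω x + 1 / 2 * x * Ω₁ x + a * (∫ s in (0 : ℝ)..x, hilbertTransform Ω s) * Ω₁ x
        - hilbertTransform Ω x * Ω x) * ψ x) + ∫ x, Ω₁ x * deriv ψ x = 0)
    {X₀ : ℝ} (hX₀ : Ω X₀ ≠ 0) {hE : W L} (hhE : hE ∈ WevenZ hL) (θ : ℝ) :
    ∃ (H₀ : ℝ) (hc : IsCentre L Ω Ω₁ H₀) (P : EspE L hL),
      profile P = deriv Ω ∧ cplxE hL P ≠ 0 ∧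
      ∀ {D₀ D₁ V₀ c m : ℝ}
        (h : GardingDataKE L hL (drift a Ω) (potential L lam Ω) (-PopCE hL lam a hc + (θ • ((innerSL ℝ hE).comp (ιEE hL))).smulRight hE)
          D₀ D₁ V₀ c m) (hm : -m < ((1 : ℂ) / 2).re),
        ∃ hu : cplxE hL P ∈ (generatorEven hL _ h ((1 : ℂ) / 2) hm).domain,
          generatorEven hL _ h ((1 : ℂ) / 2) hm ⟨cplxE hL P, hu⟩ =
            ((1 : ℂ) / 2) • cplxE hL P - ((θ : ℂ) * innerSL ℂ (realE hL hE hhE) (cplxE hL P)) • realE hL hE hhE := by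
  obtain ⟨H₀, hc, -⟩ := translationMode_isWeakImageE_of_weakZero hL lam hΩ hodd hΩ₁m hwΩ hwΩ₁ hweak
  exact ⟨H₀, hc, eigen_half_of_centre hL lam a hc hweak hX₀ hhE θ⟩

end SheetRTranslationModeWeakEigen
end Summit.NavierStokesRegularity.OSWSelfSimilar

end
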